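import Summits.Langlands.Langlands.Theses.IrreducibilityBySelfDuality
import Summits.Langlands.Langlands.Theorems.RegularTwistCM.Negative.ArchShadow
import Summits.Langlands.Langlands.Theorems.RegularTwistCM.Negative.ArchShadowParity

/-!
# Line `unimodular-normal-form` for crux `RegularTwistCM` (stmt-Langlands-14069) — checked skeleton

Crux (by name): `Summit.Langlands.Langlands.Theses.IrreducibilityBySelfDuality.RegularTwistCM` —
for `K` CM, `π` regular algebraic cuspidal on `GL₃(𝔸_K)`, `σ₀` cuspidal on `GL₂(𝔸_K)`, `ν` a
`GL₁` datum with `t_π = d · Ad(t_{σ₀})` a.e., SOME `GL₁`-twist `σ` of `σ₀` is regular algebraic.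

Idea card `Cruxes/RegularTwistCM/Ideas/unimodular-normal-form.md` (triage r1: pass ×3): NORMALISE
THE TWIST CLASS BY ITS CENTRE FIRST.  In Harish-Chandra (HC) currency — the currency of the crux
itself (`HasArchParameter`, `HasSatakeParamAt`, `GL₁` data), so that no Hecke-character type
bookkeeping and no place/embedding case analysis is needed in the composition:

1. `stub_adjointArchShadow` + `stub_descentArchPackage` (any number field): the a.e. identity
   `t_π = d · Ad(t_{σ₀})` and regular algebraicity of `π` pin the HC parameter of `σ₀` to
   `{s ι, s ι - a ι}` with `a ι ∈ ℤ ∖ {0}`, an INTEGRAL PAIRING `s ι - s ῑ ∈ ℤ` (triage r1-1/2/3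
   cross-cutting sharpen: an independent input, carried by an infinity type of `σ₀`) and PER-PAIR
   PARITY `a ι + a ῑ ∈ 2ℤ` (Clozel purity of `π`, or the Hermitian mirror; Disproof F6: exactly the
   needed archimedean input, sign irrelevant).
2. `stub_centralDatum` (any number field, any `n`): the centre of a `GL_n` datum with HC parameter
   `χ` is a `GL₁` datum with HC parameter `ι ↦ ∑ χ ι` — the handle of the normal form.
3. `stub_centralSquareRoot` (ANY number field — the ONE Weil/Chevalley use of the line, field
   independent as the card says): a `GL₁` datum `ω` of HC parameter `e` with `e ι - e ῑ` EVEN has a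
   "square root of its inverse" at the HC level: a `GL₁` datum `ψ` of parameter `p`, `2 p + e = 0`
   (finite-order ambiguity is invisible to HC parameters, so `ψ² ω` of finite order becomes an
   identity; index 2 = `squares_trick` lives inside, with Weil's exponent `M ↦ 2M`).
   Twisting `σ₀` by `ψ` (`stub_twistRealisation`) gives the UNIMODULAR `σ₁` whose HC parameter is
   FORCED: `{s + p, s - a + p} = {a/2, -a/2}` at EVERY embedding — a one-line computation below
   (the card's "centre lemma": `HC(σ₁)` is read off `π` alone).
4. `stub_angularRegulariserCM` (the ONLY place `IsCMField` is consumed — honours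
   `regularTwistCM_false_without_IsCMField`): over a CM field the 0/1 ANGULAR regulariser exists —
   for integer requests `n ι` with `n ι ≡ n ῑ (mod 2)` a `GL₁` datum with HC parameter
   `q ι ≡ n ι / 2 (mod ℤ)` (`(z_w/|z_w|)^{[n odd]}`; elementary over CM: Kronecker + one prime
   `𝔭₀ = 𝔭̄₀` + quadratic inert primes, or Weil's criterion with `t = 0`).  With `n = a + 1`:
   `σ := σ₁ ⊗ χ₂` has HC parameter `{a ι + k ι + 1/2, k ι + 1/2}` — C-algebraic, regular since
   `a ι ≠ 0` (honours `regularTwistCM_false_without_RegularAlgebraic`).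
5. `stub_twistRealisation` (any field, any `n ≥ 1`; Disproof F1 = the shared formalisation depth):
   twisting a cuspidal `GL_n` datum by a `GL₁` datum multiplies Satake parameters and SHIFTS the HC
   parameter by that of the character.  Used three times (`σ₀ ↦ σ₁ ↦ σ`, and `ψ ↦ ψ ⊗ χ₂ = χ` on
   `GL₁`, which supplies the single twisting datum `χ` of the conclusion without multiplying data).

`RegularTwistCM_of` composes the stubs into the crux BY NAME with a real proof (logic, multiset and
cast arithmetic only).  Refuted strengthenings avoided: `χ` is never asked to be algebraic / unitary /
a single global power (`not_RegularTwistCMAlgebraicTwist`, F8 `noGlobalExponent_of_maassType`): `ψ`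
carries the place-dependent Maass part of `ω_{σ₀}^{-1/2}`.  The landed Negative modules
(`Theorems/RegularTwistCM/Negative/ArchShadow{,Parity}`) are imported so this check runs against them;
`cmParity_obstructed`'s witness `(a,b) = (2,-1),(1,-1)` violates the per-pair parity clause of
`stub_descentArchPackage` and is not an instance of any stub; parity may differ ACROSS places (mixed
angular exponents), exactly as `cmParity_sufficient` allows.
-/

set_option linter.dupNamespace false

noncomputable section

open scoped BigOperators Classical
open Filter NumberField

namespace Summit.Langlands.Langlands.Cruxes.RegularTwistCM.UnimodularNormalForm

open Literature.NumberTheory.Automorphic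

/-! ## Stubs (registered obligations; `sorry` only here) -/

/-- **Stub 1a — the adjoint archimedean shadow at Harish-Chandra level** (any number field).
For cuspidal `π` on `GL₃`, `σ₀` on `GL₂`, `ν` on `GL₁` with `t_π = d · Ad(t_{σ₀})` a.e. (verbatim
the crux hypothesis), the archimedean parameters satisfy, at every complex embedding `ι`,
`HC(σ₀)(ι) = {x, y}`, `HC(ν)(ι) = {p}`, `HC(π)(ι) = {x - y + p, p, y - x + p}`.
Source: Gelbart–Jacquet 1978 Thm (9.3)(2) (the adjoint lift exists place by place, incl. `∞`) +
Jacquet–Shalika 1981 II Thm 4.4 (rigidity of isobaric representations with archimedean components: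
`π ⊗ ν⁻¹` and `Ad(σ₀)` agree a.e., hence at `∞`; the dihedral case is vacuous since `π` is cuspidal);
HC parameter of `Ad ∘ PS(z^x·, z^y·)` on `𝔰𝔩₂ ⊕ centre`.  In tree: SMO with archimedean components
(`CuspidalAutomorphicRepData.hasArchParameter_eq_of_isNearlyEquivalent` modulo its inputs),
`hasArchParameter_unique`, `card_eq_of_hasHCParameter`; GJ at `∞` has no tree shadow (size L).
Identical in content to the sibling card's `AdjointArchShadowHC` (SketchIdeator2) — shareable.
[cite: GelbartJacquet1978, Thm. 9.3] [cite: JacquetShalikaAJM1981II, Thm. 4.4] -/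
theorem stub_adjointArchShadow :
    ∀ (K : Type) [Field K] [NumberField K]
      (h1 : isCompact_glFiniteIntegralLevel 1 K) (hcpt₂ : isCompact_glFiniteIntegralLevel 2 K)
      (hcpt : isCompact_glFiniteIntegralLevel 3 K)
      (π : CuspidalAutomorphicRepData 3 K hcpt) (σ₀ : CuspidalAutomorphicRepData 2 K hcpt₂)
      (ν : CuspidalAutomorphicRepData 1 K h1),
      (∀ᶠ v in cofinite, ∀ α β : Multiset ℂ, π.1.HasSatakeParamAt v α →
          σ₀.1.HasSatakeParamAt v β → ∃ d : ℂ, ν.1.HasSatakeParamAt v {d} ∧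
            α = (((β ×ˢ β).map (fun p : ℂ × ℂ => p.1 * p.2⁻¹)).erase 1).map (fun c => d * c)) →
      ∀ (χπ χσ χν : (K →+* ℂ) → Multiset ℂ),
        π.1.HasArchParameter χπ → σ₀.1.HasArchParameter χσ → ν.1.HasArchParameter χν →
        ∀ ι : K →+* ℂ, ∃ x y p : ℂ,
          χσ ι = {x, y} ∧ χν ι = {p} ∧ χπ ι = {x - y + p, p, y - x + p} := by
  sorry

/-- **Stub 1b — the descent's archimedean package, pair-aware** (any number field).
From regular algebraicity of `π` and the adjoint shadow (Stub 1a, taken here as an explicit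
hypothesis for the SAME data), the HC parameter of `σ₀` is `{s ι, s ι - a ι}` with
(2) `a ι ∈ ℤ ∖ {0}` (C-integrality and regularity of `HC(π)(ι) ∋ x - y + p, p`: AP-means, the proved
`parity_of_pureAP` of SketchIdeator2), (3) the INTEGRAL PAIRING `s ι - s ῑ ∈ ℤ` (from a well-formed
infinity type of `σ₀`, named fact `AutomorphicRepData.exists_hasInfinityType`; `ArchWeight.exists_int_sub`
+ `IsWellFormed` conj-swap; any labelling works once `a ι ∈ ℤ`) and (4) PER-PAIR PARITY
`a ι + a ῑ ∈ 2ℤ` (`a ῑ = ± a ι` by Clozel's multiset purity of `π`, named fact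
`Clozel1990_regularAlgebraic` clause (iii), or by the Hermitian mirror
`HasArchParameter.map_neg_conj_of_skewHermitian` — Disproof F6: either suffices, the sign is irrelevant).
(3) is NOT implied by multisets + purity + central character (triage r1-1 witness
`{1/4, 5/4} / {-1/4, -5/4}`), which is why it is an explicit output here.  Size M.
[cite: Clozel1990, Lemme 4.9 and §3.3] -/
theorem stub_descentArchPackage :
    ∀ (K : Type) [Field K] [NumberField K]
      (h1 : isCompact_glFiniteIntegralLevel 1 K) (hcpt₂ : isCompact_glFiniteIntegralLevel 2 K)
      (hcpt : isCompact_glFiniteIntegralLevel 3 K)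
      (π : CuspidalAutomorphicRepData 3 K hcpt) (σ₀ : CuspidalAutomorphicRepData 2 K hcpt₂)
      (ν : CuspidalAutomorphicRepData 1 K h1),
      π.1.IsRegularAlgebraic →
      (∀ (χπ χσ χν : (K →+* ℂ) → Multiset ℂ),
        π.1.HasArchParameter χπ → σ₀.1.HasArchParameter χσ → ν.1.HasArchParameter χν →
        ∀ ι : K →+* ℂ, ∃ x y p : ℂ,
          χσ ι = {x, y} ∧ χν ι = {p} ∧ χπ ι = {x - y + p, p, y - x + p}) →
      ∃ (s : (K →+* ℂ) → ℂ) (a : (K →+* ℂ) → ℤ),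
        σ₀.1.HasArchParameter (fun ι => {s ι, s ι - a ι}) ∧
        (∀ ι, a ι ≠ 0) ∧
        (∀ ι, ∃ m : ℤ, s ι - s (ComplexEmbedding.conjugate ι) = m) ∧
        (∀ ι, ∃ r : ℤ, a ι + a (ComplexEmbedding.conjugate ι) = 2 * r) := by
  sorry

/-- **Stub 2 — the centre as a `GL₁` datum, with its Harish-Chandra type** (any number field, any
`n ≥ 1`).  An automorphic representation `π = W / W'` of `GL_n(𝔸_K)` with archimedean parameter `χ`
has a CENTRAL `GL₁` datum `ω` whose archimedean parameter is `ι ↦ {∑ χ ι}`: the central character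
`ω_π` is a Hecke character acting on `W / W'` (`AutomorphicRepData.exists_centralCharacter`, PROVED,
with its Satake shadow), the central `1 ∈ 𝔤𝔩_n(K_w)` at the place of `ι` acts by `∑ χ ι` on the
`ι`-copy (per-place form of `HasArchParameter.apply_one`, `ArchParameterSplitCentre`), and the line
`ℂ · ω_π` is a `GL₁` datum (`exists_cuspidal_glOne_hasSatakeParamAt_valueAtUniformizer`) whose
parameter is the differential of `ω_{π,∞}` (as in `archParam_complexPlace_glOne` of the sibling
`Cruxes/HalfIntegralTwistCM/Disproof.lean` §2, sorry-free there).  This is the handle of the normal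
form: it certifies that the central HC type `(∑ HC(σ₀)(ι))_ι` satisfies Weil's unit condition.
Size M/L (Lie-algebra plumbing, all ingredients in tree).
[cite: BorelJacquetCorvallis1979, §4.6 and 5.7] [cite: Clozel1990, §3.3] -/
theorem stub_centralDatum :
    ∀ (K : Type) [Field K] [NumberField K] (n : ℕ) [NeZero n]
      (h1 : isCompact_glFiniteIntegralLevel 1 K) (hcpt : isCompact_glFiniteIntegralLevel n K)
      (π : AutomorphicRepData (AutomorphyDatum.gl n K hcpt)) (χ : (K →+* ℂ) → Multiset ℂ),
      π.HasArchParameter χ →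
      ∃ ω : CuspidalAutomorphicRepData 1 K h1, ω.1.HasArchParameter (fun ι => {(χ ι).sum}) := by
  sorry

/-- **Stub 3 — the ONE square root: kill the centre** (ANY number field; the line's single
Weil/Chevalley input, field-independent as the card says).  A `GL₁` datum `ω` with HC parameter `e`
whose angular exponents `e ι - e ῑ` are all EVEN admits a `GL₁` datum `ψ` with HC parameter `p`,
`2 p ι + e ι = 0` at every embedding (`ψ = ω^{-1/2}` up to a finite-order character, which HC
parameters do not see).  Proof line: `ω = ‖·‖^{c} Ω`, `Ω` unitary of type `(m_w, y_w)` with `m_w`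
even at complex places (hypothesis; real places impose nothing); Weil's unit criterion for `Ω`
(necessity, the easy direction: `Ω_f` has finite order on `𝓞̂ˣ`, `HeckeCharacter.exists_level`) gives
`(∏_w …)^M = 1` on units, hence the half type `(-m_w/2, -y_w/2)` satisfies it with exponent `2M`
(`squares_trick`; index 2 genuinely needed: `squares_trick_tight`), so a unitary `Ψ` of that type
EXISTS (named fact `Patrikis2019_heckeCharacter_archType_iff_units` (⇐) = Weil 1956 + Chevalley 1951
Thm 1; in tree as a def) and `ψ := Ψ · ‖·‖^{-c/2}` (`exists_heckeCharacter_ideleNorm_cpow`) has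
parameter `-e/2` (GL(1) archimedean dictionary, `HasArchParameter.of_map_mulChar_detTwist` for the norm
part).  = the card's `exists_sq_eq_mul_isFiniteOrder` in HC currency.  Size L (XL if Weil (⇐) is
proved rather than assumed).  Over CM with `e` coming from Stub 2 the evenness is automatic from
the pairing + parity clauses of Stub 1b (see `RegularTwistCM_of`).
[cite: Weil1956, §1] [cite: Patrikis2019, Lemma 2.1.1 and Cor. 2.1.8] [cite: ChevalleyDeuxTheoremes1951, Thm. 1] -/
theorem stub_centralSquareRoot :
    ∀ (K : Type) [Field K] [NumberField K] (h1 : isCompact_glFiniteIntegralLevel 1 K)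
      (ω : CuspidalAutomorphicRepData 1 K h1) (e : (K →+* ℂ) → ℂ),
      ω.1.HasArchParameter (fun ι => {e ι}) →
      (∀ ι, ∃ k : ℤ, e ι - e (ComplexEmbedding.conjugate ι) = 2 * k) →
      ∃ (ψ : CuspidalAutomorphicRepData 1 K h1) (p : (K →+* ℂ) → ℂ),
        ψ.1.HasArchParameter (fun ι => {p ι}) ∧ ∀ ι, 2 * p ι + e ι = 0 := by
  sorry

/-- **Stub 4 — the 0/1 angular regulariser over a CM field** (the ONLY stub consuming
`IsCMField`; honours `regularTwistCM_false_without_IsCMField`: false over `ℚ(√2)` with requests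
`(1, 0)` by `parallel_of_unit_condition`, and over totally imaginary non-CM fields by Patrikis
Lemma 2.1.5).  For integer "parity requests" `n ι` with `n ι ≡ n ῑ (mod 2)` there is a `GL₁` datum
`χ₂` with HC parameter `q`, `q ι ≡ n ι / 2 (mod ℤ)` at every embedding: the ANGULAR character
`∏_w (z_w/|z_w|)^{A_w}`, `A_w = (n ι_w mod 2) ∈ {0,1}`, parameter `A_w/2` at `ι_w` and `-A_w/2` at
`ῑ_w` (requests may have different parity at different places — mixed angular exponents are fine,
cf. `cmParity_sufficient`; only the two embeddings of ONE place must agree).  Existence over CM is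
ELEMENTARY (card): `(z/|z|)^{A}` kills `(𝓞_K(𝔭₀)ˣ)²` for a prime `𝔭₀ = 𝔭̄₀ ∤ 2|μ_K|disc`
(`u ≡ 1 (𝔭₀) ⇒ u/ū` a root of unity `≡ 1 ⇒ u = ū` real: Kronecker,
`NumberField.Embeddings.pow_eq_one_of_norm_eq_one`), `(𝓞_K(𝔭₀)ˣ)² ⊇ 𝓞_K(𝔭₀∏𝔭ᵢ)ˣ` with `𝔭ᵢ`
inert in `K(√vᵢ)` (quadratic Chebotarev, `chebotarev_artinRep_holds` PROVED), extension through the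
finite ray class group by divisibility of `ℂˣ`, then the `GL₁` dictionary; OR Weil's criterion
(⇐) with `t = 0` and `[𝓞_Kˣ : μ_K 𝓞_{K⁺}ˣ] ≤ 2` (Mathlib `NumberField.IsCMField.indexRealUnits`).
Worked check `K = ℚ(ζ₈)`, `𝔭₀ = (3+√2)`: triage r1-1/r1-3 (PARI j009593/j009560).  Size M/L.
[cite: Patrikis2019, Lemma 2.1.5(3)] [cite: Weil1956, §1] -/
theorem stub_angularRegulariserCM :
    ∀ (K : Type) [Field K] [NumberField K], IsCMField K →
      ∀ (h1 : isCompact_glFiniteIntegralLevel 1 K) (n : (K →+* ℂ) → ℤ),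
      (∀ ι, ∃ r : ℤ, n ι - n (ComplexEmbedding.conjugate ι) = 2 * r) →
      ∃ (χ₂ : CuspidalAutomorphicRepData 1 K h1) (q : (K →+* ℂ) → ℂ),
        χ₂.1.HasArchParameter (fun ι => {q ι}) ∧ ∀ ι, ∃ k : ℤ, q ι = (n ι : ℂ) / 2 + k := by
  sorry

/-- **Stub 5 — twist realisation with archimedean control** (any number field, any `n ≥ 1`;
Disproof F1: the shared formalisation depth of every line).  For a cuspidal `GL_n` datum `π` with
HC parameter `P` and a `GL₁` datum `χ` with HC parameter `{p ι}` there is a cuspidal datum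
`π' = π ⊗ (χ ∘ det)` with `t_{π',v} = c_v · t_{π,v}` whenever `t_{χ,v} = {c_v}` (a.e.) and HC
parameter `ι ↦ P ι + p ι`.  Proof line: `χ`'s central character `θ` is a Hecke character with
`r(g)φ ≡ θ(g)φ` and `θ(ϖ_v) = c_v` (`exists_centralCharacter` at `n = 1`, PROVED, incl. the Satake
shadow); the twist `π ⊗ (θ ∘ det)` as a cuspidal datum with its Satake parameters is PROVED for an
arbitrary idèle class character (`exists_cuspidalAutomorphicRepData_twist_hecke`,
`eventually_hasSatakeParamAt_of_map_mulChar_detTwist`); the HC shift by the differential of `θ_∞`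
(= `p`, `archParam_complexPlace_glOne`) is the uncarried generalisation of
`HasArchParameter.of_map_mulChar_detTwist` from `‖·‖^s` to a general differential
(`isZFinite_mulChar_of_exp`, `HasHCParameter.of_add_smul_one` are in tree).  Size L.
[cite: BorelJacquet1979, 5.7] [cite: ArthurClozelAMS120, Ch. 3, proof of Thm. 3.1] -/
theorem stub_twistRealisation :
    ∀ (K : Type) [Field K] [NumberField K] (n : ℕ) [NeZero n]
      (h1 : isCompact_glFiniteIntegralLevel 1 K) (hcpt : isCompact_glFiniteIntegralLevel n K)
      (π : CuspidalAutomorphicRepData n K hcpt) (χ : CuspidalAutomorphicRepData 1 K h1)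
      (P : (K →+* ℂ) → Multiset ℂ) (p : (K →+* ℂ) → ℂ),
      π.1.HasArchParameter P → χ.1.HasArchParameter (fun ι => {p ι}) →
      ∃ π' : CuspidalAutomorphicRepData n K hcpt,
        (∀ᶠ v in cofinite, ∀ (β : Multiset ℂ) (c : ℂ), π.1.HasSatakeParamAt v β →
            χ.1.HasSatakeParamAt v {c} → π'.1.HasSatakeParamAt v (β.map (fun b => c * b))) ∧
        π'.1.HasArchParameter (fun ι => (P ι).map (· + p ι)) := by
  sorry

/-! ## The composition (real proof: logic + multiset / cast arithmetic) -/

/-- The regular algebraic infinity type produced by the line: weights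
`(a ι + k ι + 1/2, a ῑ + k ῑ + 1/2)` and `(k ι + 1/2, k ῑ + 1/2)` at `ι`. [folklore] -/
def lineWeight (i j : ℤ) : ArchWeight where
  a := (i : ℂ) + 1 / 2
  b := (j : ℂ) + 1 / 2
  exists_int_sub := ⟨i - j, by push_cast; ring⟩

@[simp] theorem lineWeight_a (i j : ℤ) : (lineWeight i j).a = (i : ℂ) + 1 / 2 := rfl
@[simp] theorem lineWeight_b (i j : ℤ) : (lineWeight i j).b = (j : ℂ) + 1 / 2 := rfl
@[simp] theorem lineWeight_swap (i j : ℤ) : (lineWeight i j).swap = lineWeight j i := by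
  ext <;> rfl

/-- **The crux from the five stubs** (concludes `RegularTwistCM` BY NAME).  Normal form:
`σ := σ₀ ⊗ ψ ⊗ χ₂` with `ψ = ω_{σ₀}^{-1/2}` (Stub 3 on the central datum of Stub 2) and `χ₂` the 0/1
angular regulariser for the requests `a + 1` (Stub 4); the centre lemma `HC(σ₀ ⊗ ψ) = {a/2, -a/2}`
is the identity `2p + e = 0`; `χ := ψ ⊗ χ₂` on `GL₁` (Stub 5 with `n = 1`). [folklore] -/
theorem RegularTwistCM_of :
    Summit.Langlands.Langlands.Theses.IrreducibilityBySelfDuality.RegularTwistCM := by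
  intro K _ _ hCM h1 hcpt₂ hcpt π σ₀ ν hRA hAd
  -- (1) archimedean package of the descent
  obtain ⟨s, a, hσ₀A, ha0, hpair, hpar⟩ :=
    stub_descentArchPackage K h1 hcpt₂ hcpt π σ₀ ν hRA
      (stub_adjointArchShadow K h1 hcpt₂ hcpt π σ₀ ν hAd)
  -- (2) the central GL₁ datum of σ₀ and its HC type `e = 2s - a`
  obtain ⟨ω, hω⟩ := stub_centralDatum K 2 h1 hcpt₂ σ₀.1 (fun ι => {s ι, s ι - a ι}) hσ₀A
  set e : (K →+* ℂ) → ℂ := fun ι => (({s ι, s ι - (a ι : ℂ)} : Multiset ℂ)).sum with he_def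
  have he : ∀ ι, e ι = 2 * s ι - a ι := by
    intro ι
    simp only [he_def, Multiset.insert_eq_cons, Multiset.sum_cons, Multiset.sum_singleton]
    ring
  have hωe : ω.1.HasArchParameter (fun ι => {e ι}) := hω
  -- the central angular exponents are EVEN: pairing + per-pair parity
  have heven : ∀ ι, ∃ k : ℤ, e ι - e (ComplexEmbedding.conjugate ι) = 2 * k := by
    intro ι
    obtain ⟨m, hm⟩ := hpair ι
    obtain ⟨r, hr⟩ := hpar ι
    have hr' : ((a ι : ℂ) + a (ComplexEmbedding.conjugate ι)) = 2 * r := by exact_mod_cast hr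
    refine ⟨m - a ι + r, ?_⟩
    rw [he, he]
    push_cast
    linear_combination 2 * hm + hr'
  -- (3) kill the centre: ψ = ω^{-1/2} at HC level
  obtain ⟨ψ, p, hψA, hp⟩ := stub_centralSquareRoot K h1 ω e hωe heven
  -- the unimodular twist σ₁ = σ₀ ⊗ ψ
  obtain ⟨σ₁, hσ₁S, hσ₁A⟩ :=
    stub_twistRealisation K 2 h1 hcpt₂ σ₀ ψ (fun ι => {s ι, s ι - a ι}) p hσ₀A hψA
  -- (4) the 0/1 angular regulariser for the requests `a + 1`
  have hreq : ∀ ι, ∃ r : ℤ,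
      (a ι + 1) - (a (ComplexEmbedding.conjugate ι) + 1) = 2 * r := by
    intro ι
    obtain ⟨r, hr⟩ := hpar ι
    exact ⟨r - a (ComplexEmbedding.conjugate ι), by omega⟩
  obtain ⟨χ₂, q, hχ₂A, hq⟩ := stub_angularRegulariserCM K hCM h1 (fun ι => a ι + 1) hreq
  -- (5) σ = σ₁ ⊗ χ₂ and χ = ψ ⊗ χ₂
  obtain ⟨σ, hσS, hσA⟩ :=
    stub_twistRealisation K 2 h1 hcpt₂ σ₁ χ₂ (fun ι => ({s ι, s ι - a ι} : Multiset ℂ).map (· + p ι))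
      q hσ₁A hχ₂A
  obtain ⟨χ, hχS, -⟩ := stub_twistRealisation K 1 h1 h1 ψ χ₂ (fun ι => {p ι}) q hψA hχ₂A
  refine ⟨σ, χ, ?_, ?_⟩
  · -- regular algebraicity of σ: HC(σ)(ι) = {a ι + k ι + 1/2, k ι + 1/2}
    choose k hk using hq
    have hx : ∀ ι, s ι + p ι + q ι = ((a ι + k ι : ℤ) : ℂ) + 1 / 2 := by
      intro ι
      have h1' := hp ι
      rw [he] at h1'
      have h2' := hk ι
      push_cast at h2' ⊢
      linear_combination (1 / 2 : ℂ) * h1' + h2'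
    have hy : ∀ ι, s ι - a ι + p ι + q ι = ((k ι : ℤ) : ℂ) + 1 / 2 := by
      intro ι
      have h1' := hp ι
      rw [he] at h1'
      have h2' := hk ι
      push_cast at h2' ⊢
      linear_combination (1 / 2 : ℂ) * h1' + h2'
    set T : InfinityType K 2 := fun ι =>
      {lineWeight (a ι + k ι) (a (ComplexEmbedding.conjugate ι) + k (ComplexEmbedding.conjugate ι)),
        lineWeight (k ι) (k (ComplexEmbedding.conjugate ι))} with hT_def
    have hTa : ∀ ι, (T ι).map ArchWeight.a =
        (({s ι, s ι - (a ι : ℂ)} : Multiset ℂ).map (· + p ι)).map (· + q ι) := by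
      intro ι
      simp only [hT_def, Multiset.insert_eq_cons, Multiset.map_cons, Multiset.map_singleton,
        lineWeight_a]
      rw [hx ι, hy ι]
    refine ⟨T, ⟨⟨fun ι => by simp [hT_def], fun ι => ?_⟩, ?_⟩, ?_, ?_⟩
    · -- conj-swap compatibility
      simp only [hT_def, Multiset.insert_eq_cons, Multiset.map_cons, Multiset.map_singleton,
        lineWeight_swap]
      rw [ComplexEmbedding.involutive_conjugate K ι]
    · -- the archimedean parameter is the one delivered by the two twists
      have hfun : (fun ι => (T ι).map ArchWeight.a) =
          fun ι => (({s ι, s ι - (a ι : ℂ)} : Multiset ℂ).map (· + p ι)).map (· + q ι) :=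
        funext hTa
      rw [hfun]
      exact hσA
    · -- C-algebraic: exponents in 1/2 + ℤ
      intro ι w hw
      simp only [hT_def, Multiset.insert_eq_cons, Multiset.mem_cons, Multiset.mem_singleton] at hw
      rcases hw with rfl | rfl
      · exact ⟨a ι + k ι, a (ComplexEmbedding.conjugate ι) + k (ComplexEmbedding.conjugate ι),
          by rw [lineWeight_a]; push_cast; ring, by rw [lineWeight_b]; push_cast; ring⟩
      · exact ⟨k ι, k (ComplexEmbedding.conjugate ι),
          by rw [lineWeight_a]; push_cast; ring, by rw [lineWeight_b]; push_cast; ring⟩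
    · -- regular: a ι ≠ 0
      intro ι
      simp only [hT_def, Multiset.insert_eq_cons, Multiset.map_cons, Multiset.map_singleton,
        lineWeight_a, Multiset.nodup_cons, Multiset.mem_singleton, Multiset.nodup_singleton,
        and_true]
      intro h
      apply ha0 ι
      have h' : ((a ι : ℤ) : ℂ) = 0 := by push_cast at h ⊢; linear_combination h
      exact_mod_cast h'
  · -- Satake parameters: t_σ = (c₂ c₁) · t_{σ₀}, t_χ = {c₂ c₁}
    filter_upwards [hσ₁S, hσS, hχS, ψ.1.hasSatakeParamAt_cofinite_holds,
      χ₂.1.hasSatakeParamAt_cofinite_holds] with v h1v h2v h3v h4v h5v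
    intro β hβ
    obtain ⟨γ₁, hγ₁⟩ := h4v
    obtain ⟨c₁, rfl⟩ := Multiset.card_eq_one.mp hγ₁.card_eq
    obtain ⟨γ₂, hγ₂⟩ := h5v
    obtain ⟨c₂, rfl⟩ := Multiset.card_eq_one.mp hγ₂.card_eq
    refine ⟨c₂ * c₁, ?_, ?_⟩
    · have h := h3v {c₁} c₂ hγ₁ hγ₂
      rwa [Multiset.map_singleton] at h
    · have h := h2v _ c₂ (h1v β c₁ hβ hγ₁) hγ₂
      have hmap : (β.map (fun b => c₁ * b)).map (fun b => c₂ * b) = β.map (fun b => c₂ * c₁ * b) := by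
        rw [Multiset.map_map]
        congr 1
        funext b
        simp [Function.comp, mul_assoc]
      rwa [hmap] at h

end Summit.Langlands.Langlands.Cruxes.RegularTwistCM.UnimodularNormalForm

end
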